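import Mathlib
import Literature.MathematicalPhysics.QuantumFieldTheory.PottsGaugeWilsonLoopMonotonicity
import HarnessLib

/-!
# The Peierls area law for Wilson loops of `q`-state Potts lattice gauge theory at strong coupling,
# via the plaquette random-cluster representation — PROVED on the torus `𝕋^d_L`

Tenth file of the transcription of the Fortuin–Kasteleyn-type ("plaquette random-cluster")
representation of `q`-state Potts lattice gauge theory (companions: `PlaquetteRandomCluster` —
setting, readings (R1)–(R3), (R7) and the SCOPE caveat —, `PottsGaugeEdwardsSokal`,
`PottsGaugeWilsonLoopTopology` (Theorem 5: `𝔼_ν W_γ = μ(V_γ)`),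
`PottsGaugeWilsonLoopPercolationBounds` (the Bernoulli sandwich `μ_{p,q}(V_γ) ≤ ψ_p(V_γ)`),
`PottsGaugeWilsonLoopMonotonicity` (`ψ_r(S ⊆ ω) = r^{|S|}`, the area-law LOWER bound)).

## Scope (read this first)

Nothing in this file bears on the Clay Yang–Mills mass-gap problem: the gauge group is the finite
abelian group `ℤ_q`, the volume is the finite torus, and the regime is STRONG coupling (small `β`),
where an area law holds for every lattice gauge theory by high-temperature expansion
(Osterwalder–Seiler; in the tree for `SU(N)`: `LatticeGaugeTorusAreaLaw`). In the `ym` ladder only the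
conditional finite-`𝕋⁴` rung `BalabanLadder.UV` is closed by any current route; `BalabanLadder.IR`
is untouched. The file is typed because the cell's census of graphical representations (rows A4/A9)
lists the area-law/perimeter-law dichotomy of the plaquette random-cluster model and asks for the
printed consequences of the current/FK expansions ([ForsstromViklund2025currents, §6]) in Lean.

## Sources

* M. P. Forsström, F. Viklund, *Current expansion and couplings for Ising lattice gauge theory*,
  arXiv:2502.19942 [ForsstromViklund2025currents], **Proposition 6.5** and its proof
  [corpus:paper:arxiv-2502.19942 p0010 L96–p0011 L40]: for Ising lattice gauge theory on a box
  `B_N ⊂ ℤ^m` and `β < 1/(4(m-1))` (their normalisation), "the stronger estimate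
  `𝔼_{N,β}[W_γ] ≤ (4(m-1)β)^{area(γ)} / (1 - 4(m-1)β)`", `area(γ) = min_{n ∈ 𝒞_γ} Σ_p n(p)` the least
  number of plaquettes of a surface bounded by `γ`; proof = a Peierls/greedy enumeration: a current
  with boundary `γ` contains one built in `j ≥ area(γ)` steps, each step repairing the first defective
  edge by one of the `≤ 2(m-1)` plaquettes containing it, so `|𝒞_{γ,j}| ≤ (2(m-1))^j`; also
  **Proposition 6.2** (`𝔼_{N,β}[W_γ] > 0`) [p0010 L32].
* P. Duncan, B. Schweinhart, CMP **406** (2025), arXiv:2207.08339 [DuncanSchweinhart2025],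
  **Theorem 7** and §5.5 [corpus:paper:arxiv-2207.08339 p0006 L29–45]: area-law regime of
  `μ(V_γ)` for the plaquette random-cluster model at small `p` "together with a comparison with
  plaquette percolation", hence of Potts lattice gauge Wilson loops for prime `q` via Theorem 5
  (constants not explicit there); §1 [p0005 L12]: "if `γ = ∂ρ` is a `1`-boundary and `ρ` is the
  minimal bounding chain then the expectation of `W_{∂ρ}` should decay as `e^{-c|ρ|}`".
* M. Aizenman, J. T. Chayes, L. Chayes, J. Fröhlich, L. Russo, CMP **92** (1983) 19–69 (the original
  Peierls-type area law for random surfaces / `ℤ₂` gauge theory; cited through the two sources above).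

## What is typed (transcriber's form, flagged)

The FK route, not the random-current route: for ANY finite field `F` of coefficients, Bernoulli
plaquette percolation `ψ_r` on `𝕋^d_L` satisfies the Peierls bound
`ψ_r(V_γ) ≤ (κ r)^{area(γ)} / (1 - κ r)`, `κ = κ(d,F) = 2(d-1)(|F|-1)` (`peierlsConst`), whenever
`κ r < 1` (`bernoulli_eventProb_nullHomologous_le`); by the sandwich the same bound holds for the
plaquette random-cluster measure `μ_{p,q}`, `q ≥ 1` (`eventProb_nullHomologous_le_areaLaw`); and by
Theorem 5, for prime `q` and `p = 1 - e^{-β}`,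
`𝔼_{ν_β} W_γ ≤ (κ p)^{area(γ)} / (1 - κ p) ≤ (κ β)^{area(γ)} / (1 - κ β)` for `κ β < 1`,
`κ = 2(d-1)(q-1)` (`pottsExpect_wilsonLoopVar_re_le_areaLaw`, `…_le_areaLaw'`). Here
`area γ = min {|supp τ| : ∂τ = γ}` over `F`-valued plaquette `2`-chains (`0` if `γ` bounds nothing,
in which case `V_γ = ∅` and `𝔼 W_γ = 0` anyway, `pottsExpect_wilsonLoopVar_eq_zero`). The greedy
enumeration of the printed proof is `peierlsStep`/`peierlsReach` (each step: first defective edge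
`e` — `∂σ(e) ≠ γ(e)` —, one of the `≤ 2(d-1)` plaquettes of `cofaces e` on which `σ` vanishes, one
of the `|F|-1` non-zero values), with `card_peierlsReach_le` (`≤ κ^j` chains after `j` steps),
`card_chainSupport_of_mem_peierlsReach` (exactly `j` plaquettes) and `exists_mem_peierlsReach`
(every `τ` with `∂τ = γ` contains a greedy chain with boundary `γ`). Differences from the printed
statement, all on the safe side of faithfulness: torus instead of a box (the count `2(d-1)` of
plaquettes per edge is the same), general prime `q` (the factor `|F|-1`), and the FK parameter
`p = 1 - e^{-β}` in the Duncan–Schweinhart normalisation `e^{-βH}`, `H = -Σ_σ δ_{(δf)(σ),0}` in place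
of the current weight `2β_FV` (for `q = 2`, `β = 4β_FV`; the printed constant `4(m-1)β_FV = (m-1)β`
is better than this file's `2(m-1)(1-e^{-β})` by a factor `< 2`; we do not claim the printed constant).
The evaluation `area(∂R) = RT` for an `R × T` rectangle (used in [ForsstromViklund2025currents,
Prop. 6.5] to pass to the quark potential `V_β(R) ≥ a_β R`) is NOT typed here.
Also typed: **Prop. 6.2** for prime `q` on the torus, `pottsExpect_wilsonLoopVar_re_pos`
(`𝔼_{ν_β} W_{∂c} > 0`, `β > 0`), a one-line corollary of the area-law lower bound of the companion file.

Everything in this file is PROVED; no named fact is introduced.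
-/

open Finset

namespace Literature.MathematicalPhysics.QuantumFieldTheory

namespace PlaquetteRC

open LatticeForm

variable {d L : ℕ} [NeZero L]

/-! ### The plaquettes containing an edge -/

section Cofaces

/-- The plaquettes of `𝕋^d_L` having the positively oriented edge `e = (x, k)` in their boundary:
for each direction `j ≠ k`, the plaquette in the plane `{k, j}` based at `x` and the one based at
`x - e_j` ("`|∂̂e| ≤ 2(m-1)` for any edge `e`"). [cite: ForsstromViklund2025currents, §6 proof of Prop. 6.5] -/
def cofaces (x : Site d L) (k : Fin d) : Finset (Plaquette d L) :=
  Finset.univ.filter fun P =>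
    (P.2.1.1 = k ∧ (P.1 = x ∨ P.1 + te P.2.1.2 = x)) ∨ (P.2.1.2 = k ∧ (P.1 = x ∨ P.1 + te P.2.1.1 = x))

/-- A plaquette not in `cofaces x k` does not contain the edge `(x,k)` in its boundary:
`(δ𝟙_{(x,k)})(P) = 0`. [cite: ForsstromViklund2025currents, §6 proof of Prop. 6.5] -/
theorem res_td₁_edgeInd_eq_zero {R : Type*} [CommRing R] {x : Site d L} {k : Fin d}
    {P : Plaquette d L} (hP : P ∉ cofaces x k) : res (td₁ (edgeInd (R := R) x k)) P = 0 := by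
  obtain ⟨y, ⟨i, j⟩, hij⟩ := P
  simp only [cofaces, Finset.mem_filter, Finset.mem_univ, true_and] at hP
  have h1 : ¬(y = x ∧ i = k) := fun h => hP (Or.inl ⟨h.2, Or.inl h.1⟩)
  have h2 : ¬(y + te i = x ∧ j = k) := fun h => hP (Or.inr ⟨h.2, Or.inr h.1⟩)
  have h3 : ¬(y + te j = x ∧ i = k) := fun h => hP (Or.inl ⟨h.2, Or.inr h.1⟩)
  have h4 : ¬(y = x ∧ j = k) := fun h => hP (Or.inr ⟨h.2, Or.inl h.1⟩)
  simp only [res, td₁, edgeInd, if_neg h1, if_neg h2, if_neg h3, if_neg h4]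
  ring

/-- **At most `2(d-1)` plaquettes contain a given edge.** [cite: ForsstromViklund2025currents, §6 proof of Prop. 6.5 ("|∂̂e| ≤ 2(m-1)")] -/
theorem card_cofaces_le (x : Site d L) (k : Fin d) : (cofaces x k).card ≤ 2 * (d - 1) := by
  classical
  -- parametrisation by (the other direction `j ≠ k`, based at `x` or at `x - e_j`)
  let plane : {j : Fin d // j ≠ k} → {p : Fin d × Fin d // p.1 < p.2} := fun j =>
    if h : k < j.1 then ⟨(k, j.1), h⟩ else ⟨(j.1, k), lt_of_le_of_ne (not_lt.mp h) j.2⟩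
  let f : {j : Fin d // j ≠ k} × Bool → Plaquette d L := fun jb =>
    (if jb.2 then x - te jb.1.1 else x, plane jb.1)
  have hsub : cofaces x k ⊆ Finset.univ.image f := by
    intro P hP
    simp only [cofaces, Finset.mem_filter, Finset.mem_univ, true_and] at hP
    rw [Finset.mem_image]
    obtain ⟨y, ⟨i, j⟩, hij⟩ := P
    simp only at hP hij
    rcases hP with ⟨hik, hy⟩ | ⟨hjk, hy⟩
    · subst hik
      have hplane : plane ⟨j, (ne_of_lt hij).symm⟩ = ⟨(i, j), hij⟩ := by
        simp only [plane, dif_pos hij]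
      rcases hy with hy | hy
      · exact ⟨(⟨j, (ne_of_lt hij).symm⟩, false), Finset.mem_univ _, by simp [f, hplane, hy]⟩
      · refine ⟨(⟨j, (ne_of_lt hij).symm⟩, true), Finset.mem_univ _, ?_⟩
        simp [f, hplane, (eq_sub_of_add_eq hy)]
    · subst hjk
      have hplane : plane ⟨i, ne_of_lt hij⟩ = ⟨(i, j), hij⟩ := by
        simp only [plane, dif_neg (not_lt.mpr hij.le)]
      rcases hy with hy | hy
      · exact ⟨(⟨i, ne_of_lt hij⟩, false), Finset.mem_univ _, by simp [f, hplane, hy]⟩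
      · refine ⟨(⟨i, ne_of_lt hij⟩, true), Finset.mem_univ _, ?_⟩
        simp [f, hplane, (eq_sub_of_add_eq hy)]
  calc (cofaces x k).card ≤ (Finset.univ.image f).card := Finset.card_le_card hsub
    _ ≤ (Finset.univ : Finset ({j : Fin d // j ≠ k} × Bool)).card := Finset.card_image_le
    _ = 2 * (d - 1) := by
        rw [Finset.card_univ, Fintype.card_prod, Fintype.card_bool, Fintype.card_subtype_compl,
          Fintype.card_fin, Fintype.card_unique]
        ring

end Cofaces

/-! ### Plaquette `2`-chains: one-plaquette modifications and the boundary at an edge -/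

section Chains

variable {F : Type*} [Field F]

/-- `∂(σ + a𝟙_P)(e) = ∂σ(e) + a (δ𝟙_e)(P)`. [cite: DuncanSchweinhart2025, §1.1 Def. 2 (δf(σ) = f(∂σ))] -/
theorem bd₂_add_smul_plaqInd (σ : Plaquette d L → F) (P : Plaquette d L) (a : F)
    (x : Site d L) (k : Fin d) :
    bd₂ (σ + a • plaqInd (R := F) P) x k = bd₂ σ x k + a * res (td₁ (edgeInd (R := F) x k)) P := by
  simp only [bd₂, Pi.add_apply, Pi.smul_apply, smul_eq_mul, add_mul, Finset.sum_add_distrib]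
  congr 1
  simp only [plaqInd, mul_ite, mul_one, mul_zero, ite_mul, zero_mul, Finset.sum_ite_eq',
    Finset.mem_univ, if_true]

/-- **The repair step is possible.** If `∂σ` and `∂τ` differ at the edge `e = (x,k)` then `σ` and `τ`
differ on one of the plaquettes containing `e`. [cite: ForsstromViklund2025currents, §6 proof of Prop. 6.5 ("the edge e_j is well defined … pick any of the 2(m-1) plaquettes in ∂̂e_j")] -/
theorem exists_mem_cofaces_of_bd₂_ne {σ τ : Plaquette d L → F} {x : Site d L} {k : Fin d}
    (h : bd₂ σ x k ≠ bd₂ τ x k) : ∃ P ∈ cofaces x k, σ P ≠ τ P := by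
  have hsum : ∑ P : Plaquette d L, (σ P - τ P) * res (td₁ (edgeInd (R := F) x k)) P ≠ 0 := by
    simp only [sub_mul, Finset.sum_sub_distrib]
    exact sub_ne_zero.mpr h
  obtain ⟨P, -, hP⟩ := Finset.exists_ne_zero_of_sum_ne_zero hsum
  refine ⟨P, ?_, ?_⟩
  · by_contra hPc
    exact hP (by rw [res_td₁_edgeInd_eq_zero hPc, mul_zero])
  · intro hστ
    exact hP (by rw [hστ, sub_self, zero_mul])

variable [DecidableEq F]

/-- Adding `a • 𝟙_P` (`a ≠ 0`) to a chain vanishing at `P` adds `P` to the support.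
[cite: ForsstromViklund2025currents, §6 proof of Prop. 6.5 (n_{j+1}(p_j) = n_j(p_j) + 1)] -/
theorem chainSupport_add_smul_plaqInd {σ : Plaquette d L → F} {P : Plaquette d L} {a : F}
    (hσ : σ P = 0) (ha : a ≠ 0) :
    chainSupport (σ + a • plaqInd (R := F) P) = insert P (chainSupport σ) := by
  ext Q
  simp only [chainSupport, Finset.mem_filter, Finset.mem_univ, true_and, Finset.mem_insert,
    Pi.add_apply, Pi.smul_apply, plaqInd, smul_eq_mul, mul_ite, mul_one, mul_zero]
  by_cases hQ : Q = P
  · subst hQ; simp [hσ, ha]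
  · simp [hQ]

/-- A chain vanishing at `P` does not have `P` in its support. [cite: DuncanSchweinhart2025, §2.1 (chains)] -/
theorem not_mem_chainSupport_of_eq_zero {σ : Plaquette d L → F} {P : Plaquette d L} (hσ : σ P = 0) :
    P ∉ chainSupport σ := by
  simp [chainSupport, hσ]

end Chains

/-! ### The greedy (Peierls) enumeration of spanning chains -/

section Peierls

variable (F : Type*) [Field F] [Fintype F] [DecidableEq F]

/-- The Peierls constant `κ(d, F) = 2(d-1)(|F|-1)`: the number of choices in one greedy step
(a plaquette containing the defective edge, a non-zero coefficient).
[cite: ForsstromViklund2025currents, §6 proof of Prop. 6.5 (|𝒞_{γ,j}| ≤ (2(m-1))^j)] -/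
def peierlsConst (d : ℕ) : ℕ := 2 * (d - 1) * (Fintype.card F - 1)

variable {F}

/-- `κ(d, ℤ_q) = 2(d-1)(q-1)`. [cite: ForsstromViklund2025currents, §6 proof of Prop. 6.5] -/
theorem peierlsConst_zmod (q : ℕ) [NeZero q] : peierlsConst (ZMod q) d = 2 * (d - 1) * (q - 1) := by
  simp [peierlsConst, ZMod.card]

/-- **One greedy step** from a chain `σ` towards boundary `γ`: if `∂σ ≠ γ`, pick (by choice) a
defective edge `e` (`∂σ(e) ≠ γ(e)`) and return all chains `σ + a𝟙_P` with `P` a plaquette of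
`cofaces e` on which `σ` vanishes and `a ≠ 0`; if `∂σ = γ`, no successor.
[cite: ForsstromViklund2025currents, §6 proof of Prop. 6.5 (construction of n_{j+1} from n_j)] -/
noncomputable def peierlsStep (γ : Site d L → Fin d → F) (σ : Plaquette d L → F) :
    Finset (Plaquette d L → F) :=
  if h : ∃ e : Site d L × Fin d, bd₂ σ e.1 e.2 ≠ γ e.1 e.2 then
    (((cofaces h.choose.1 h.choose.2).filter fun P => σ P = 0) ×ˢ
        (Finset.univ.filter fun a : F => a ≠ 0)).image
      fun Pa => σ + Pa.2 • plaqInd (R := F) Pa.1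
  else ∅

/-- **The chains reachable in `j` greedy steps** from `0` (the sets `𝒞_{γ,j}` of the printed proof,
before intersecting with `{∂σ = γ}`). [cite: ForsstromViklund2025currents, §6 proof of Prop. 6.5 (𝒞_{γ,j})] -/
noncomputable def peierlsReach (γ : Site d L → Fin d → F) : ℕ → Finset (Plaquette d L → F)
  | 0 => {0}
  | n + 1 => (peierlsReach γ n).biUnion (peierlsStep γ)

/-- One greedy step has at most `κ = 2(d-1)(|F|-1)` outcomes. [cite: ForsstromViklund2025currents, §6 proof of Prop. 6.5] -/
theorem card_peierlsStep_le (γ : Site d L → Fin d → F) (σ : Plaquette d L → F) :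
    (peierlsStep γ σ).card ≤ peierlsConst F d := by
  unfold peierlsStep peierlsConst
  split_ifs with h
  · refine Finset.card_image_le.trans ?_
    rw [Finset.card_product]
    gcongr
    · exact (Finset.card_filter_le _ _).trans (card_cofaces_le _ _)
    · rw [Finset.filter_ne' Finset.univ (0 : F), Finset.card_erase_of_mem (Finset.mem_univ _),
        Finset.card_univ]
  · simp

/-- **`|𝒞_{γ,j}| ≤ κ^j`.** [cite: ForsstromViklund2025currents, §6 proof of Prop. 6.5 ("|𝒞_{γ,j}| ≤ (2(m-1))^j")] -/
theorem card_peierlsReach_le (γ : Site d L → Fin d → F) (n : ℕ) :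
    (peierlsReach γ n).card ≤ peierlsConst F d ^ n := by
  induction n with
  | zero => simp [peierlsReach]
  | succ n ih =>
    rw [peierlsReach, pow_succ]
    refine Finset.card_biUnion_le.trans ?_
    refine (Finset.sum_le_sum fun σ _ => card_peierlsStep_le γ σ).trans ?_
    rw [Finset.sum_const, smul_eq_mul]
    exact Nat.mul_le_mul_right _ ih

/-- Shape of a successor: `σ' = σ + a𝟙_P` with `σ(P) = 0`, `a ≠ 0`. [cite: ForsstromViklund2025currents, §6 proof of Prop. 6.5] -/
theorem exists_eq_add_of_mem_peierlsStep {γ : Site d L → Fin d → F} {σ σ' : Plaquette d L → F}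
    (h : σ' ∈ peierlsStep γ σ) :
    ∃ P : Plaquette d L, ∃ a : F, σ P = 0 ∧ a ≠ 0 ∧ σ' = σ + a • plaqInd (R := F) P := by
  unfold peierlsStep at h
  split_ifs at h with he
  · simp only [Finset.mem_image, Finset.mem_product, Finset.mem_filter, Finset.mem_univ,
      true_and] at h
    obtain ⟨⟨P, a⟩, ⟨⟨-, hP⟩, ha⟩, rfl⟩ := h
    exact ⟨P, a, hP, ha, rfl⟩
  · simp at h

/-- **A chain reached in `j` steps has exactly `j` plaquettes** (`Σ_p n_j(p) = j`).
[cite: ForsstromViklund2025currents, §6 proof of Prop. 6.5] -/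
theorem card_chainSupport_of_mem_peierlsReach {γ : Site d L → Fin d → F} {n : ℕ}
    {σ : Plaquette d L → F} (h : σ ∈ peierlsReach γ n) : (chainSupport σ).card = n := by
  induction n generalizing σ with
  | zero =>
    simp only [peierlsReach, Finset.mem_singleton] at h
    subst h
    simp [chainSupport]
  | succ n ih =>
    rw [peierlsReach, Finset.mem_biUnion] at h
    obtain ⟨σ₀, h₀, hstep⟩ := h
    obtain ⟨P, a, hP, ha, rfl⟩ := exists_eq_add_of_mem_peierlsStep hstep
    rw [chainSupport_add_smul_plaqInd hP ha,
      Finset.card_insert_of_notMem (not_mem_chainSupport_of_eq_zero hP), ih h₀]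

/-- **The greedy step guided by a spanning chain `τ`.** If `σ` (reached in `n` steps) agrees with `τ`
on its own support and `∂σ ≠ γ = ∂τ`, then some plaquette `P` with `σ(P) = 0 ≠ τ(P)` repairs the
chosen defective edge, and `σ + τ(P)𝟙_P` is reached in `n+1` steps.
[cite: ForsstromViklund2025currents, §6 proof of Prop. 6.5 ("n = n^γ + (n - n^γ)")] -/
theorem peierls_extend {γ : Site d L → Fin d → F} {τ σ : Plaquette d L → F} (hτ : bd₂ τ = γ)
    {n : ℕ} (hσ : σ ∈ peierlsReach γ n) (hcomp : ∀ P, σ P ≠ 0 → σ P = τ P) (hne : bd₂ σ ≠ γ) :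
    ∃ P : Plaquette d L, σ P = 0 ∧ τ P ≠ 0 ∧
      σ + τ P • plaqInd (R := F) P ∈ peierlsReach γ (n + 1) := by
  have h : ∃ e : Site d L × Fin d, bd₂ σ e.1 e.2 ≠ γ e.1 e.2 := by
    by_contra hall
    exact hne (funext fun x => funext fun k => not_not.mp (not_exists.mp hall (x, k)))
  have hdef : bd₂ σ h.choose.1 h.choose.2 ≠ bd₂ τ h.choose.1 h.choose.2 := by
    rw [hτ]; exact h.choose_spec
  obtain ⟨P, hPc, hP⟩ := exists_mem_cofaces_of_bd₂_ne hdef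
  have hσP : σ P = 0 := by
    by_contra h0
    exact hP (hcomp P h0)
  have hτP : τ P ≠ 0 := fun h0 => hP (by rw [hσP, h0])
  refine ⟨P, hσP, hτP, ?_⟩
  rw [peierlsReach, Finset.mem_biUnion]
  refine ⟨σ, hσ, ?_⟩
  rw [peierlsStep, dif_pos h]
  simp only [Finset.mem_image, Finset.mem_product, Finset.mem_filter, Finset.mem_univ, true_and]
  exact ⟨(P, τ P), ⟨⟨hPc, hσP⟩, hτP⟩, rfl⟩

/-- Induction behind `exists_mem_peierlsReach`: on the number of plaquettes of `supp τ` not yet in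
`supp σ`. [cite: ForsstromViklund2025currents, §6 proof of Prop. 6.5] -/
private theorem exists_mem_peierlsReach_aux {γ : Site d L → Fin d → F} {τ : Plaquette d L → F}
    (hτ : bd₂ τ = γ) :
    ∀ m n (σ : Plaquette d L → F), σ ∈ peierlsReach γ n → (∀ P, σ P ≠ 0 → σ P = τ P) →
      (chainSupport τ \ chainSupport σ).card = m →
      ∃ n' σ', σ' ∈ peierlsReach γ n' ∧ bd₂ σ' = γ ∧ ∀ P, σ' P ≠ 0 → σ' P = τ P := by
  intro m
  induction m with
  | zero =>
    intro n σ hσ hcomp hcard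
    by_cases hne : bd₂ σ = γ
    · exact ⟨n, σ, hσ, hne, hcomp⟩
    · exfalso
      obtain ⟨P, hσP, hτP, -⟩ := peierls_extend hτ hσ hcomp hne
      rw [Finset.card_eq_zero, Finset.sdiff_eq_empty_iff_subset] at hcard
      have hPσ : P ∈ chainSupport σ := hcard (by simp [chainSupport, hτP])
      exact not_mem_chainSupport_of_eq_zero hσP hPσ
  | succ m ih =>
    intro n σ hσ hcomp hcard
    by_cases hne : bd₂ σ = γ
    · exact ⟨n, σ, hσ, hne, hcomp⟩
    · obtain ⟨P, hσP, hτP, hmem⟩ := peierls_extend hτ hσ hcomp hne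
      refine ih (n + 1) _ hmem ?_ ?_
      · intro Q hQ
        by_cases hQP : Q = P
        · subst hQP
          simp [plaqInd, hσP]
        · have hQ' : (σ + τ P • plaqInd (R := F) P) Q = σ Q := by
            simp [plaqInd, hQP]
          rw [hQ'] at hQ ⊢
          exact hcomp Q hQ
      · rw [chainSupport_add_smul_plaqInd hσP hτP, Finset.sdiff_insert,
          Finset.card_erase_of_mem, hcard, Nat.add_sub_cancel]
        exact Finset.mem_sdiff.mpr ⟨by simp [chainSupport, hτP], not_mem_chainSupport_of_eq_zero hσP⟩

/-- **Every spanning chain contains a greedy one.** If `∂τ = γ` then some chain `σ` reached by the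
greedy enumeration has `∂σ = γ` and `supp σ ⊆ supp τ` (the decomposition `n = n^γ + (n - n^γ)` of
the printed proof). [cite: ForsstromViklund2025currents, §6 proof of Prop. 6.5] -/
theorem exists_mem_peierlsReach {γ : Site d L → Fin d → F} {τ : Plaquette d L → F}
    (hτ : bd₂ τ = γ) :
    ∃ n σ, σ ∈ peierlsReach γ n ∧ bd₂ σ = γ ∧ chainSupport σ ⊆ chainSupport τ := by
  obtain ⟨n, σ, hσ, hbd, hcomp⟩ := exists_mem_peierlsReach_aux hτ _ 0 0
    (by simp [peierlsReach]) (fun P hP => absurd rfl hP) rfl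
  refine ⟨n, σ, hσ, hbd, fun P hP => ?_⟩
  simp only [chainSupport, Finset.mem_filter, Finset.mem_univ, true_and] at hP ⊢
  rw [← hcomp P hP]
  exact hP

end Peierls

/-! ### The minimal spanning area of a `1`-chain -/

section Area

variable {R : Type*} [CommRing R] [DecidableEq R]

/-- **`area(γ)`**: the least number of plaquettes of an `R`-valued plaquette `2`-chain `τ` with
`∂τ = γ` ("`ρ` the minimal bounding chain"; `min_{n ∈ 𝒞_γ} Σ_p n(p)`); `0` if `γ` bounds no chain.
[cite: ForsstromViklund2025currents, §6 before Prop. 6.5 (area(γ))] -/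
noncomputable def area (γ : Site d L → Fin d → R) : ℕ :=
  sInf {n | ∃ τ : Plaquette d L → R, bd₂ τ = γ ∧ (chainSupport τ).card = n}

/-- Every spanning chain has at least `area(γ)` plaquettes. [cite: ForsstromViklund2025currents, §6 proof of Prop. 6.5 ("Σ_p n(p) ≥ area(γ)")] -/
theorem area_le_card_chainSupport {γ : Site d L → Fin d → R} {τ : Plaquette d L → R}
    (h : bd₂ τ = γ) : area γ ≤ (chainSupport τ).card :=
  Nat.sInf_le ⟨τ, h, rfl⟩

/-- A non-zero boundary has `area ≥ 1`. [cite: ForsstromViklund2025currents, §6 before Prop. 6.5 (area(γ))] -/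
theorem one_le_area {γ : Site d L → Fin d → R} (hγ : γ ≠ 0) {τ : Plaquette d L → R}
    (h : bd₂ τ = γ) : 1 ≤ area γ := by
  have hmem : area γ ∈ {n | ∃ τ : Plaquette d L → R, bd₂ τ = γ ∧ (chainSupport τ).card = n} :=
    Nat.sInf_mem ⟨_, τ, h, rfl⟩
  obtain ⟨τ₀, hτ₀, hcard⟩ := hmem
  by_contra hlt
  rw [not_le, Nat.lt_one_iff] at hlt
  rw [hlt, Finset.card_eq_zero] at hcard
  have hτ0 : τ₀ = 0 := by
    funext P
    by_contra hP
    have hmem : P ∈ chainSupport τ₀ := by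
      simp only [chainSupport, Finset.mem_filter, Finset.mem_univ, true_and]
      exact hP
    rw [hcard] at hmem
    simp at hmem
  apply hγ
  rw [← hτ₀, hτ0]
  funext x k
  simp [bd₂]

end Area

/-! ### The union bound and the Peierls area law -/

section AreaLaw

variable (F : Type*) [Field F]

/-- **Union bound**: if `E ⊆ ⋃_{i ∈ s} A_i` then `μ(E) ≤ Σ_{i ∈ s} μ(A_i)`.
[cite: ForsstromViklund2025currents, §6 proof of Prop. 6.5 (sum over 𝒞_{γ,j})] -/
theorem eventProb_le_sum_of_subset {p q : ℝ} (hp : p ∈ Set.Icc (0 : ℝ) 1) (hq : 0 ≤ q)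
    {ι : Type*} (s : Finset ι) (E : Set (Finset (Plaquette d L)))
    (A : ι → Set (Finset (Plaquette d L))) (h : ∀ ω ∈ E, ∃ i ∈ s, ω ∈ A i) :
    eventProb F p q E ≤ ∑ i ∈ s, eventProb F p q (A i) := by
  classical
  unfold eventProb
  rw [Finset.sum_comm]
  refine Finset.sum_le_sum fun ω _ => ?_
  have hnn : ∀ j ∈ s, (0 : ℝ) ≤ if ω ∈ A j then prob F p q ω else 0 := fun j _ => by
    split_ifs
    · exact prob_nonneg' F hp hq ω
    · exact le_rfl
  by_cases hω : ω ∈ E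
  · rw [if_pos hω]
    obtain ⟨i, hi, hωi⟩ := h ω hω
    refine le_trans ?_ (Finset.single_le_sum hnn hi)
    rw [if_pos hωi]
  · rw [if_neg hω]
    exact Finset.sum_nonneg hnn

variable [Fintype F] [DecidableEq F]

/-- **The Peierls area law for Bernoulli plaquette percolation** on `𝕋^d_L`: for `r ∈ [0,1]` with
`κ r < 1`, `κ = 2(d-1)(|F|-1)`, and every `F`-valued `1`-chain `γ`,
`ψ_r(V_γ) ≤ (κ r)^{area(γ)} / (1 - κ r)` — uniformly in the volume.
[cite: ForsstromViklund2025currents, Prop. 6.5 (proof: "Σ_{j ≥ area(γ)} (2(m-1))^j (2β)^j")] -/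
theorem bernoulli_eventProb_nullHomologous_le {r : ℝ} (hr : r ∈ Set.Icc (0 : ℝ) 1)
    (hκ : (peierlsConst F d : ℝ) * r < 1) (γ : Site d L → Fin d → F) :
    eventProb F r 1 {ω | IsNullHomologousIn ω γ} ≤
      ((peierlsConst F d : ℝ) * r) ^ area γ / (1 - (peierlsConst F d : ℝ) * r) := by
  classical
  set κ : ℝ := (peierlsConst F d : ℝ) * r with hκdef
  have hκ0 : 0 ≤ κ := mul_nonneg (Nat.cast_nonneg _) hr.1
  set N : ℕ := Fintype.card (Plaquette d L) with hNdef
  -- the greedy chains with boundary `γ`, indexed by their number of plaquettes `n ≤ N`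
  let s : Finset (Σ _ : ℕ, Plaquette d L → F) :=
    (Finset.range (N + 1)).sigma fun n => (peierlsReach γ n).filter fun σ => bd₂ σ = γ
  have hcover : ∀ ω ∈ {ω : Finset (Plaquette d L) | IsNullHomologousIn ω γ},
      ∃ i ∈ s, ω ∈ {ω' : Finset (Plaquette d L) | chainSupport i.2 ⊆ ω'} := by
    rintro ω ⟨c, hc, hcγ⟩
    obtain ⟨n, σ, hσ, hbd, hsub⟩ := exists_mem_peierlsReach hcγ
    have hcω : chainSupport c ⊆ ω := by
      intro P hP
      simp only [chainSupport, Finset.mem_filter, Finset.mem_univ, true_and] at hP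
      by_contra hPω
      exact hP (hc P hPω)
    refine ⟨⟨n, σ⟩, ?_, hsub.trans hcω⟩
    rw [Finset.mem_sigma, Finset.mem_range, Finset.mem_filter]
    refine ⟨Nat.lt_succ_of_le ?_, hσ, hbd⟩
    rw [← card_chainSupport_of_mem_peierlsReach hσ]
    exact Finset.card_le_univ _
  calc eventProb F r 1 {ω | IsNullHomologousIn ω γ}
      ≤ ∑ i ∈ s, eventProb F r 1 {ω' | chainSupport i.2 ⊆ ω'} :=
        eventProb_le_sum_of_subset F ⟨hr.1, hr.2⟩ zero_le_one s _ _ hcover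
    _ = ∑ n ∈ Finset.range (N + 1),
          ∑ σ ∈ (peierlsReach γ n).filter (fun σ => bd₂ σ = γ), r ^ n := by
        rw [Finset.sum_sigma]
        refine Finset.sum_congr rfl fun n _ => Finset.sum_congr rfl fun σ hσ => ?_
        rw [bernoulli_eventProb_supset,
          card_chainSupport_of_mem_peierlsReach (Finset.mem_filter.mp hσ).1]
    _ ≤ ∑ n ∈ Finset.range (N + 1), if area γ ≤ n then κ ^ n else 0 := by
        refine Finset.sum_le_sum fun n _ => ?_
        rw [Finset.sum_const, nsmul_eq_mul]
        split_ifs with hn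
        · calc (((peierlsReach γ n).filter fun σ => bd₂ σ = γ).card : ℝ) * r ^ n
              ≤ (peierlsConst F d : ℝ) ^ n * r ^ n := by
                refine mul_le_mul_of_nonneg_right ?_ (pow_nonneg hr.1 n)
                exact_mod_cast (Finset.card_filter_le _ _).trans (card_peierlsReach_le γ n)
            _ = κ ^ n := by rw [hκdef, mul_pow]
        · have hempty : ((peierlsReach γ n).filter fun σ => bd₂ σ = γ) = ∅ := by
            rw [Finset.filter_eq_empty_iff]
            intro σ hσ hbd
            exact hn ((area_le_card_chainSupport hbd).trans
              (card_chainSupport_of_mem_peierlsReach hσ).le)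
          rw [hempty, Finset.card_empty, Nat.cast_zero, zero_mul]
    _ = ∑ n ∈ (Finset.range (N + 1)).filter (fun n => area γ ≤ n), κ ^ n :=
        (Finset.sum_filter _ _).symm
    _ ≤ ∑ n ∈ Finset.Ico (area γ) (area γ + (N + 1)), κ ^ n := by
        refine Finset.sum_le_sum_of_subset_of_nonneg ?_ fun n _ _ => pow_nonneg hκ0 n
        intro n hn
        rw [Finset.mem_filter, Finset.mem_range] at hn
        rw [Finset.mem_Ico]
        omega
    _ = κ ^ area γ * ∑ j ∈ Finset.range (N + 1), κ ^ j := by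
        rw [Finset.sum_Ico_eq_sum_range, Nat.add_sub_cancel_left, Finset.mul_sum]
        exact Finset.sum_congr rfl fun j _ => pow_add κ (area γ) j
    _ ≤ κ ^ area γ * (1 - κ)⁻¹ := by
        gcongr
        exact sum_le_hasSum _ (fun j _ => pow_nonneg hκ0 j) (hasSum_geometric_of_lt_one hκ0 hκ)
    _ = κ ^ area γ / (1 - κ) := (div_eq_mul_inv _ _).symm

/-- **The Peierls area law for the plaquette random-cluster model** `μ_{p,q}`, `p ∈ (0,1)`, `q ≥ 1`,
`κ p < 1`: `μ_{p,q}(V_γ) ≤ (κ p)^{area(γ)} / (1 - κ p)` ("a comparison with plaquette percolation").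
[cite: DuncanSchweinhart2025, Thm. 7 and §5.5 (area-law regime at small p)] -/
theorem eventProb_nullHomologous_le_areaLaw {p q : ℝ} (hp : p ∈ Set.Ioo (0 : ℝ) 1) (hq : 1 ≤ q)
    (hκ : (peierlsConst F d : ℝ) * p < 1) (γ : Site d L → Fin d → F) :
    eventProb F p q {ω | IsNullHomologousIn ω γ} ≤
      ((peierlsConst F d : ℝ) * p) ^ area γ / (1 - (peierlsConst F d : ℝ) * p) :=
  (eventProb_sandwich F hp hq (isUpperSet_nullHomologous γ)).2.trans
    (bernoulli_eventProb_nullHomologous_le F ⟨hp.1.le, hp.2.le⟩ hκ γ)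

/-- Monotonicity of the Peierls bound `x ↦ x^a / (1 - x)` on `[0,1)`. [cite: ForsstromViklund2025currents, §6 proof of Prop. 6.5] -/
private theorem peierlsBound_mono {x y : ℝ} (hx : 0 ≤ x) (hxy : x ≤ y) (hy : y < 1) (a : ℕ) :
    x ^ a / (1 - x) ≤ y ^ a / (1 - y) :=
  div_le_div₀ (pow_nonneg (hx.trans hxy) a) (pow_le_pow_left₀ hx hxy a) (sub_pos.mpr hy)
    (sub_le_sub_left hxy 1)

variable (q : ℕ) [Fact q.Prime]

/-- **The Peierls area law for Wilson loops of `q`-state Potts lattice gauge theory on `𝕋^d_L`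
(prime `q`, FK parametrisation).** For `β > 0` with `κ (1 - e^{-β}) < 1`, `κ = 2(d-1)(q-1)`, and
every `ℤ_q` `1`-chain `γ`: `𝔼_{ν_β} W_γ ≤ (κ p)^{area(γ)} / (1 - κ p)`, `p = 1 - e^{-β}` — uniformly in
`L`. [cite: ForsstromViklund2025currents, Prop. 6.5 (proof, "the stronger estimate"); DuncanSchweinhart2025, Thm. 7 and §5.5] -/
theorem pottsExpect_wilsonLoopVar_re_le_areaLaw {β : ℝ} (hβ : 0 < β)
    (hκ : (peierlsConst (ZMod q) d : ℝ) * esParam β < 1) (γ : Site d L → Fin d → ZMod q) :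
    (pottsExpect (d := d) (L := L) (ZMod q) β (wilsonLoopVar q γ)).re ≤
      ((peierlsConst (ZMod q) d : ℝ) * esParam β) ^ area γ /
        (1 - (peierlsConst (ZMod q) d : ℝ) * esParam β) :=
  (wilsonLoop_percolation_sandwich q hβ γ).2.trans
    (bernoulli_eventProb_nullHomologous_le (ZMod q)
      ⟨(esParam_mem_Ioo hβ).1.le, (esParam_mem_Ioo hβ).2.le⟩ hκ γ)

/-- **The same in the coupling `β` itself** (`1 - e^{-β} ≤ β`): for `0 < β` with `κ β < 1`,
`κ = 2(d-1)(q-1)`, `𝔼_{ν_β} W_γ ≤ (κ β)^{area(γ)} / (1 - κ β)` — the shape of the printed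
`(4(m-1)β)^{area(γ)}/(1 - 4(m-1)β)` (there: `q = 2`, a box, the random-current normalisation).
[cite: ForsstromViklund2025currents, Prop. 6.5] -/
theorem pottsExpect_wilsonLoopVar_re_le_areaLaw' {β : ℝ} (hβ : 0 < β)
    (hκ : (peierlsConst (ZMod q) d : ℝ) * β < 1) (γ : Site d L → Fin d → ZMod q) :
    (pottsExpect (d := d) (L := L) (ZMod q) β (wilsonLoopVar q γ)).re ≤
      ((peierlsConst (ZMod q) d : ℝ) * β) ^ area γ / (1 - (peierlsConst (ZMod q) d : ℝ) * β) := by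
  have hK : (0 : ℝ) ≤ (peierlsConst (ZMod q) d : ℝ) := Nat.cast_nonneg _
  have hpβ : esParam β ≤ β := by
    have h := Real.add_one_le_exp (-β)
    simp only [esParam]
    linarith
  have hle : (peierlsConst (ZMod q) d : ℝ) * esParam β ≤ (peierlsConst (ZMod q) d : ℝ) * β :=
    mul_le_mul_of_nonneg_left hpβ hK
  exact (pottsExpect_wilsonLoopVar_re_le_areaLaw q hβ (hle.trans_lt hκ) γ).trans
    (peierlsBound_mono (mul_nonneg hK (esParam_mem_Ioo hβ).1.le) hle hκ _)

/-- **Strict positivity of Wilson loop expectations** (`q` prime, `β > 0`): `𝔼_{ν_β} W_{∂c} > 0` for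
every plaquette `2`-chain `c` — the torus/FK-route form of [ForsstromViklund2025currents, Prop. 6.2]
(there `q = 2` via random currents). [cite: ForsstromViklund2025currents, Prop. 6.2] -/
theorem pottsExpect_wilsonLoopVar_re_pos {β : ℝ} (hβ : 0 < β) (c : Plaquette d L → ZMod q) :
    0 < (pottsExpect (d := d) (L := L) (ZMod q) β (wilsonLoopVar q (bd₂ c))).re := by
  refine lt_of_lt_of_le (pow_pos ?_ _) (pow_le_pottsExpect_wilsonLoopVar_re q hβ c)
  have h1 : 0 < Real.exp β - 1 := by
    rw [sub_pos]
    exact Real.one_lt_exp_iff.mpr hβ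
  have hq : (0 : ℝ) ≤ q := Nat.cast_nonneg q
  positivity

end AreaLaw

end PlaquetteRC

end Literature.MathematicalPhysics.QuantumFieldTheory
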